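import Mathlib
import HarnessLib
import Summits.NavierStokesRegularity.NavierStokesRegularity.Theorems.TypeILiouvilleTypeIDoorLocalAxis
import Summits.NavierStokesRegularity.NavierStokesRegularity.Theorems.TypeILiouvilleShorelinePlanarWallAnyDirection

/-!
# TypeILiouvilleTypeIDoorLocalLine — crux (L) stmt-NavierStokesRegularity-10661 `TypeIliouvilleL`, registered stub
# `stub_typeIAncientLiouville_knssGauge` (= door stmt-4050): A TYPE-I PROFILE WITH ONE LOCALLY 2½-DIMENSIONAL PATCH IS ZERO

Helper for stmt-NavierStokesRegularity-10661 (`--supports`); theorems only, no definitions, no named-fact hypotheses;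
closes no item; Navier–Stokes regularity is NOT proved here (leafhand seat of the EulerZoomLiouville route; third of the
localized-symmetry cells of the door, after `…TypeIDoorLocalAxis` (rotations) and `…TypeIDoorLocalHelix` (screw motions)).

The planar wall of the (L) residual is a tree theorem in print's class P: a bounded ancient mild flow which, on ONE
nonempty open set of ONE slice, is invariant under small translations along a unit direction `e`
(`v t₀ (x + s e) = v t₀ x`, `|s| < δ₀`) is one constant vector
(`TypeILiouvilleShoreline.classP_const_of_locallyTranslationInvariant`, KNSS Thm 5.1 chain + vertical heat Liouville).
For the KNSS-gauge Type-I class of the door the constant is then killed by the gauge: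

* `typeI_sliceConst_of_locallyTranslationInvariant` — every slice of such a Type-I field is a constant vector (backward
  shifts `t ↦ u(t − δ)` into class P for all small `δ`, `typeI_shift_classP`);
* `typeI_eq_zero_of_locallyTranslationInvariant` — **hence `u ≡ 0`** (`IsTypeIAncientMild.eq_zero_of_slice_const`);
  `typeIAncientLiouville_onLocalLine` — the reading on the binders of stmt-4050 / the registered stub VERBATIM.

READING (three files together): a counterexample to the load-bearing door 4050 has, on NO slice, an open patch on which it
is invariant under ANY one-parameter group of Euclidean motions of `ℝ³` — translations (this file), rotations
(`…LocalAxis`), screw motions (`…LocalHelix`); the (L) residual L_Q has the same portrait except that its helical and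
axisymmetric-with-swirl cells remain open.
[cite: KochNadirashviliSereginSverak2009, Thm 5.1 (arXiv:0709.3599 p. 9), §1 p. 3; LemarieRieusset2016, Thm. 9.12 (PDF p. 260)]
-/

noncomputable section

open MeasureTheory Filter Set Function Metric
open scoped Topology
open Literature.Analysis Literature.Analysis.FluidPDE Literature.Analysis.UnboundedOperators
open Summit.NavierStokesRegularity.NavierStokesRegularity.Theorems.TypeILiouvilleShoreline
open Summit.NavierStokesRegularity.NavierStokesRegularity.Theorems.TypeILiouvilleTypeIDoorLocalAxis

set_option linter.dupNamespace false

namespace Summit.NavierStokesRegularity.NavierStokesRegularity.Theorems.TypeILiouvilleTypeIDoorLocalLine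

variable {K : ℝ} {W : ℝ → EuclideanSpace ℝ (Fin 3) → EuclideanSpace ℝ (Fin 3)}

/-- **Every slice of a Type-I field with one locally translation-invariant patch is a constant vector**: for `τ < 0`
shift backward by `δ = min(−τ₁, −τ)/2`; the shifted flow is in class P (`typeI_shift_classP`, weakly divergence free
by `IsTypeIAncientMild.isWeaklyDivFree`), locally translation invariant at time `τ₁ + δ`, hence one constant vector
(`classP_const_of_locallyTranslationInvariant`), and `τ + δ < 0` reads off the slice `τ`.
[cite: KochNadirashviliSereginSverak2009, Thm 5.1 (arXiv:0709.3599 p. 9)] -/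
theorem typeI_sliceConst_of_locallyTranslationInvariant (hW : IsTypeIAncientMild K W)
    {e : EuclideanSpace ℝ (Fin 3)} (he : ‖e‖ = 1) {τ₁ δ₀ : ℝ} (hτ₁ : τ₁ < 0) (hδ₀ : 0 < δ₀)
    {U : Set (EuclideanSpace ℝ (Fin 3))} (hUo : IsOpen U) (hUne : U.Nonempty)
    (hloc : ∀ s ∈ Ioo (-δ₀) δ₀, ∀ x ∈ U, W τ₁ (x + s • e) = W τ₁ x) :
    ∀ τ < 0, ∃ b : EuclideanSpace ℝ (Fin 3), ∀ x, W τ x = b := by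
  intro τ hτ
  set δ : ℝ := min (-τ₁) (-τ) / 2 with hδ_def
  have hδ : 0 < δ := by
    rw [hδ_def]; have := lt_min (neg_pos.2 hτ₁) (neg_pos.2 hτ); linarith
  have hδ₁ : τ₁ + δ < 0 := by
    rw [hδ_def]; have := min_le_left (-τ₁) (-τ); linarith
  have hδτ : τ + δ < 0 := by
    rw [hδ_def]; have := min_le_right (-τ₁) (-τ); linarith
  obtain ⟨hc, hK, hm⟩ := typeI_shift_classP hW hδ
  have hd : ∀ t < 0, IsWeaklyDivFree ((fun t x => W (t - δ) x) t) := fun t ht =>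
    (hW.comp_sub_right hδ.le).isWeaklyDivFree ht
  have hloc' : ∀ s ∈ Ioo (-δ₀) δ₀, ∀ x ∈ U,
      (fun t x => W (t - δ) x) (τ₁ + δ) (x + s • e) = (fun t x => W (t - δ) x) (τ₁ + δ) x := by
    intro s hs x hx
    simp only [add_sub_cancel_right]
    exact hloc s hs x hx
  obtain ⟨b, hb⟩ := classP_const_of_locallyTranslationInvariant hc hK hd hm he hδ₁ hδ₀ hUo hUne hloc'
  refine ⟨b, fun x => ?_⟩
  have h := hb (τ + δ) hδτ x
  simp only [add_sub_cancel_right] at h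
  exact h

/-- **A KNSS-GAUGE TYPE-I ANCIENT MILD FIELD WITH ONE LOCALLY TRANSLATION-INVARIANT PATCH VANISHES**: all slices are
constant vectors (previous theorem) and the Oseen gauge with the Type-I bound kills slice-constant fields
(`IsTypeIAncientMild.eq_zero_of_slice_const`). [cite: KochNadirashviliSereginSverak2009, Thm 5.1 and Remark 6.1 (arXiv:0709.3599)] -/
theorem typeI_eq_zero_of_locallyTranslationInvariant (hW : IsTypeIAncientMild K W)
    {e : EuclideanSpace ℝ (Fin 3)} (he : ‖e‖ = 1) {τ₁ δ₀ : ℝ} (hτ₁ : τ₁ < 0) (hδ₀ : 0 < δ₀)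
    {U : Set (EuclideanSpace ℝ (Fin 3))} (hUo : IsOpen U) (hUne : U.Nonempty)
    (hloc : ∀ s ∈ Ioo (-δ₀) δ₀, ∀ x ∈ U, W τ₁ (x + s • e) = W τ₁ x) :
    ∀ τ < 0, ∀ x, W τ x = 0 := by
  classical
  have hslice := typeI_sliceConst_of_locallyTranslationInvariant hW he hτ₁ hδ₀ hUo hUne hloc
  set b : ℝ → EuclideanSpace ℝ (Fin 3) := fun t =>
    if ht : t < 0 then Classical.choose (hslice t ht) else 0 with hb_def
  have hub : ∀ t < 0, ∀ x, W t x = b t := by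
    intro t ht x
    have h := Classical.choose_spec (hslice t ht) x
    simp only [hb_def, dif_pos ht]
    exact h
  intro τ hτ x
  exact hW.eq_zero_of_slice_const hub hτ x

/-- **Reading on the door / the registered stub VERBATIM.**  With the binders of
`Theses.SymmetryModuliCount.TypeIAncientLiouville` (stmt-4050) = `stub_typeIAncientLiouville_knssGauge`: a smooth,
divergence-free, Oseen-kernel-mild, Type-I-in-time field one of whose slices is, on one nonempty open patch, invariant
under small translations along some unit direction vanishes identically.
[cite: KochNadirashviliSereginSverak2009, Thm 5.1 (arXiv:0709.3599 p. 9)] -/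
theorem typeIAncientLiouville_onLocalLine :
    ∀ (C : ℝ) (u : ℝ → EuclideanSpace ℝ (Fin 3) → EuclideanSpace ℝ (Fin 3)),
      ContDiffOn ℝ (⊤ : ℕ∞) (Function.uncurry u) (Set.Iio 0 ×ˢ Set.univ) ∧
      (∀ t < 0, Literature.Analysis.FluidPDE.VectorCalculus.IsDivFree (u t)) ∧
      (∀ s t : ℝ, s < t → t < 0 → ∀ x,
        u t x = Literature.Analysis.FluidPDE.heatFlow (u s) (t - s) x -
          ∫ τ in Set.Ioo s t, ∫ y,
            Literature.Analysis.FluidPDE.oseenKernel (t - τ) (x - y) (u τ y) (u τ y)) ∧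
      Literature.Analysis.FluidPDE.HasTypeITimeDecay C u →
      (∃ (e : EuclideanSpace ℝ (Fin 3)) (τ₁ δ₀ : ℝ) (U : Set (EuclideanSpace ℝ (Fin 3))),
          ‖e‖ = 1 ∧ τ₁ < 0 ∧ 0 < δ₀ ∧ IsOpen U ∧ U.Nonempty ∧
          ∀ s ∈ Set.Ioo (-δ₀) δ₀, ∀ x ∈ U, u τ₁ (x + s • e) = u τ₁ x) →
      ∀ t < 0, ∀ x, u t x = 0 := by
  intro C u hu hloc
  obtain ⟨e, τ₁, δ₀, U, he, hτ₁, hδ₀, hUo, hUne, hl⟩ := hloc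
  exact typeI_eq_zero_of_locallyTranslationInvariant (isTypeIAncientMild_iff.2 hu) he hτ₁ hδ₀ hUo hUne hl

end Summit.NavierStokesRegularity.NavierStokesRegularity.Theorems.TypeILiouvilleTypeIDoorLocalLine

end
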